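import Summits.HodgeConjecture.CorCM.Census.QuaternionColumnEvenPivot
import Summits.HodgeConjecture.CorCM.Census.QuaternionColumnResidualGen

/-!
# The quaternion column at EVEN level, V: THE LAW `μ(Q_{4n}, c) = φ₂(Q_{4n}, c)` for EVERY even `n ≥ 4`

COR-CM (cell `pub-hodgecm2`), count-neutral kernel combinatorics by the binder seat b09 (gen 40; lane RELATIVE SPLITTING, part IX = the capstone of gen 39ʼs
QUATERNION COLUMN at even level), on `Census/QuaternionColumnResidualGen.lean` (every residual type reduces mod `2` to the two diagonal rows of biarcs
modulo the target of `qfam`), `Census/QuaternionColumnEvenPivot.lean` (`isLeast_card_gfaces_generate_quaternion_even`: the law modulo residual generation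
mod `2`), `Census/CoinvariantTypeSum.lean` (`ts2`, `exists_forall_ts2_eq_of_mem_hodge2`) and gen 39ʼs `mem_arc_succ_iff`, `barc_inj`, `rt_c_ne`,
`rt_c_barc`, all BY NAME.  Theorems only: no definition, no `decide` beyond closed identities in `ZMod 2`, no certificate, no named fact, no `sorry`.
HONEST FRAMING: `HC_CM` is NOT proved, here or anywhere in the tree; nothing here is a period or a headline.

* §1 A vector mod `2` whose coefficients are constant on the pairs `{Ψ, Ψ·c}` is a sum of pairs (`mem_pair2_of_forall_apply_eq`).
* §2 **WINDOW SLIDING**: on the diagonal rows `barc p p`, `barc (p+1) p` the type sum mod `2` at `a (j+1)` and at `xa j` differ exactly by the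
  coefficients of `barc (j+1) (j+1)` and its complement, and at `a j` / `xa j` by those of `barc (j+1) j` and its complement; so a HODGE vector mod `2`
  supported on the diagonal rows has complement-invariant coefficients and is a sum of pairs (`mem_pair2_of_hodge2_of_rows`).
* §3 **RESIDUAL GENERATION MOD `2`** (`residual_generation_qfam`, hypothesis (R) of parts I/III, every `n ≥ 3`): every Hodge vector mod `2` supported on
  the residual types of `T₀ = barc 0 0` lies in `pair2 + 𝔽₂⟨base changes of red (qfam n)⟩`.
* §4 **THE QUATERNION LAW AT EVEN LEVEL** (`isLeast_card_gfaces_generate_quaternion_even_law`): for EVERY even `n ≥ 4`, `G = Q_{4n}`, `c = a n`: the least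
  number of rank-four face relations whose base changes generate the integer Hodge lattice of `(G, c)` modulo pairs is EXACTLY `φ₂(G, c)` — gen 39ʼs law
  freed of the hypothesis `n = 2^m`; the first non-`2`-group column closed by the splitting method (no Sylow subgroup, no factorisation: the group-free
  residual criterion of `Census/TwoAdicSplittingTraceResidual.lean`).  E.g. `μ(Q₂₄) = φ₂(Q₂₄)` (lit-andre-3ʼs certificate row `172`), `Q₄₀`, `Q₄₈`, ….

## References
* [Pohlmann1968] H. Pohlmann, Algebraic cycles on abelian varieties of complex multiplication type, Ann. of Math. 88 (1968), Thm 1.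
* [Milne1999] J. S. Milne, Lefschetz motives and the Tate conjecture, Compositio Math. 117 (1999), Prop. 2.1, p. 54.
-/

namespace Summit.HodgeConjecture.CorCM.Census.QuaternionColumn

open Finset QuaternionGroup
open Summit.HodgeConjecture.CorCM.Prior.AllgGroup.RfwfAllgGroup
open Summit.HodgeConjecture.CorCM.Census.BlockParity
open Summit.HodgeConjecture.CorCM.Census.Coinvariant
open Summit.HodgeConjecture.CorCM.Census.BaseBlock
open Summit.HodgeConjecture.CorCM.Census.TwistGeneration

noncomputable section

variable {n : ℕ} [NeZero n]

/-! ## §1 Complement-invariant coefficients ⟹ a sum of pairs -/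

/-- `Ψ·c⁻¹·c⁻¹ = Ψ`. [folklore] -/
theorem rt_c_rt_c (Ψ : CMF (QuaternionGroup n) (c n)) : rt (c n) (c n) (rt (c n) (c n) Ψ) = Ψ := by
  rw [← rt_mul, c_mul_c, rt_one]

/-- The reduction of the pair of `Ψ` is `[Ψ] + [Ψ·c⁻¹]` and lies in `pair2`. [folklore] -/
theorem single_add_single_rt_c_mem_pair2 (Ψ : CMF (QuaternionGroup n) (c n)) :
    Finsupp.single Ψ (1 : ZMod 2) + Finsupp.single (rt (c n) (c n) Ψ) 1 ∈ pair2 (c n) := by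
  rw [← red_pair]
  exact Submodule.subset_span ⟨pair (c n) Ψ, pair_mem_pairSet (c n) Ψ, rfl⟩

/-- **A vector mod `2` whose coefficients are constant on the pairs `{Ψ, Ψ·c⁻¹}` is a sum of pairs.** (Strong induction on the support: remove the
pair through a member of the support.) [folklore] -/
theorem mem_pair2_of_forall_apply_eq : ∀ (k : ℕ) (v : CMF (QuaternionGroup n) (c n) →₀ ZMod 2), v.support.card ≤ k →
    (∀ Ψ, v Ψ = v (rt (c n) (c n) Ψ)) → v ∈ pair2 (c n)
  | 0, v, hk, _ => by
    have h : v = 0 := Finsupp.support_eq_empty.mp (Finset.card_eq_zero.mp (Nat.le_zero.mp hk))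
    rw [h]; exact Submodule.zero_mem _
  | k + 1, v, hk, hv => by
    by_cases h0 : v = 0
    · rw [h0]; exact Submodule.zero_mem _
    obtain ⟨Ψ, hΨ⟩ := Finsupp.support_nonempty_iff.mpr h0
    have hne : rt (c n) (c n) Ψ ≠ Ψ := rt_c_ne Ψ
    set w := v - v Ψ • (Finsupp.single Ψ (1 : ZMod 2) + Finsupp.single (rt (c n) (c n) Ψ) 1) with hw
    have hwapp : ∀ Φ, w Φ = v Φ - v Ψ * ((if Ψ = Φ then 1 else 0) + (if rt (c n) (c n) Ψ = Φ then 1 else 0)) := fun Φ => by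
      rw [hw, Finsupp.sub_apply, Finsupp.smul_apply, Finsupp.add_apply, Finsupp.single_apply, Finsupp.single_apply, smul_eq_mul]
    have hwΨ : w Ψ = 0 := by rw [hwapp, if_pos rfl, if_neg hne, add_zero, mul_one, sub_self]
    have hwΨ' : w (rt (c n) (c n) Ψ) = 0 := by
      rw [hwapp, if_neg hne.symm, if_pos rfl, zero_add, mul_one, ← hv Ψ, sub_self]
    have hwΦ : ∀ Φ, Φ ≠ Ψ → Φ ≠ rt (c n) (c n) Ψ → w Φ = v Φ := fun Φ h1 h2 => by
      rw [hwapp, if_neg (Ne.symm h1), if_neg (Ne.symm h2), add_zero, mul_zero, sub_zero]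
    -- the support of `w` shrinks
    have hsub : w.support ⊆ v.support.erase Ψ := by
      intro Φ hΦ
      rw [Finsupp.mem_support_iff] at hΦ
      have h1 : Φ ≠ Ψ := fun e => hΦ (by rw [e, hwΨ])
      have h2 : Φ ≠ rt (c n) (c n) Ψ := fun e => hΦ (by rw [e, hwΨ'])
      rw [hwΦ Φ h1 h2] at hΦ
      exact Finset.mem_erase.mpr ⟨h1, Finsupp.mem_support_iff.mpr hΦ⟩
    have hcard : w.support.card ≤ k := by
      have h := (Finset.card_le_card hsub).trans (Finset.card_erase_le (s := v.support) (a := Ψ))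
      have h' : (v.support.erase Ψ).card = v.support.card - 1 := Finset.card_erase_of_mem hΨ
      have := Finset.card_le_card hsub
      omega
    -- `w` has complement-invariant coefficients
    have hwinv : ∀ Φ, w Φ = w (rt (c n) (c n) Φ) := by
      intro Φ
      by_cases h1 : Φ = Ψ
      · rw [h1, hwΨ, hwΨ']
      by_cases h2 : Φ = rt (c n) (c n) Ψ
      · rw [h2, rt_c_rt_c, hwΨ', hwΨ]
      have h1' : rt (c n) (c n) Φ ≠ Ψ := fun e => h2 (by rw [← e, rt_c_rt_c])
      have h2' : rt (c n) (c n) Φ ≠ rt (c n) (c n) Ψ := fun e => h1 (by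
        have := congrArg (rt (c n) (c n)) e; rwa [rt_c_rt_c, rt_c_rt_c] at this)
      rw [hwΦ Φ h1 h2, hwΦ _ h1' h2', ← hv Φ]
    have hwmem := mem_pair2_of_forall_apply_eq k w hcard hwinv
    have e : v = w + v Ψ • (Finsupp.single Ψ (1 : ZMod 2) + Finsupp.single (rt (c n) (c n) Ψ) 1) := by rw [hw]; abel
    rw [e]
    exact Submodule.add_mem _ hwmem (Submodule.smul_mem _ _ (single_add_single_rt_c_mem_pair2 Ψ))

/-! ## §2 Window sliding on the diagonal rows -/

/-- The type sum mod `2` as a sum over the support. [folklore] -/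
theorem ts2_apply_eq_sum (v : CMF (QuaternionGroup n) (c n) →₀ ZMod 2) (x : QuaternionGroup n) :
    ts2 (c n) v x = ∑ Φ ∈ v.support, v Φ * (if x ∈ Φ.1 then 1 else 0) := by
  rw [ts2, Finsupp.linearCombination_apply, Finsupp.sum, Finset.sum_apply]
  exact Finset.sum_congr rfl fun Φ _ => by rw [Pi.smul_apply, smul_eq_mul]

/-- `(n − 1).val = n − 1 < n` in `ℤ/2n`. [folklore] -/
theorem val_n_sub_one_lt : ((n : ZMod (2 * n)) - 1).val < n := by
  have hn := NeZero.ne n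
  rw [val_sub_one_of_ne natCast_n_ne_zero, val_n]; omega

/-- **Window sliding, diagonal row**: `[a (j+1) ∈ barc p p] + [xa j ∈ barc p p] = [p = j+1 ∨ p = j+1+n]` in `ZMod 2`. [folklore] -/
theorem window_diag (j p : ZMod (2 * n)) :
    ((if (a (j + 1) : QuaternionGroup n) ∈ (barc p p).1 then (1 : ZMod 2) else 0) +
        if (xa j : QuaternionGroup n) ∈ (barc p p).1 then (1 : ZMod 2) else 0) =
      if p = j + 1 ∨ p = j + 1 + (n : ZMod (2 * n)) then 1 else 0 := by
  have hn := NeZero.ne n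
  by_cases h1 : p = j + 1
  · subst h1
    have hA : (a (j + 1) : QuaternionGroup n) ∈ (barc (j + 1) (j + 1)).1 := by
      rw [a_mem_barc, sub_self, ZMod.val_zero]; omega
    have hX : (xa j : QuaternionGroup n) ∉ (barc (j + 1) (j + 1)).1 := by
      rw [xa_mem_barc, show j - (j + 1) = (-1 : ZMod (2 * n)) by ring, val_neg_one]; omega
    rw [if_pos hA, if_neg hX, if_pos (Or.inl rfl), add_zero]
  by_cases h2 : p = j + 1 + (n : ZMod (2 * n))
  · subst h2
    have hA : (a (j + 1) : QuaternionGroup n) ∉ (barc (j + 1 + (n : ZMod (2 * n))) (j + 1 + (n : ZMod (2 * n)))).1 := by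
      rw [a_mem_barc, show j + 1 - (j + 1 + (n : ZMod (2 * n))) = -(n : ZMod (2 * n)) by ring, neg_eq_zero_sub, sub_n_eq_add_n, zero_add,
        val_n]; omega
    have hX : (xa j : QuaternionGroup n) ∈ (barc (j + 1 + (n : ZMod (2 * n))) (j + 1 + (n : ZMod (2 * n)))).1 := by
      rw [xa_mem_barc, show j - (j + 1 + (n : ZMod (2 * n))) = -(n : ZMod (2 * n)) - 1 by ring, neg_eq_zero_sub, sub_n_eq_add_n, zero_add]
      exact val_n_sub_one_lt
    rw [if_neg hA, if_pos hX, if_pos (Or.inr rfl), zero_add]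
  · have key : (a (j + 1) : QuaternionGroup n) ∈ (barc p p).1 ↔ (xa j : QuaternionGroup n) ∈ (barc p p).1 := by
      rw [a_mem_barc, xa_mem_barc, show j - p = j + 1 - (p + 1) by ring, mem_arc_succ_iff (j + 1) p]
      have hne : j + 1 ≠ p := fun h => h1 h.symm
      have hne' : j + 1 ≠ p + (n : ZMod (2 * n)) := fun h => h2 (by rw [h, add_assoc, two_n_eq_zero, add_zero])
      constructor
      · intro h; exact Or.inl ⟨h, hne⟩
      · rintro (⟨h, -⟩ | h)
        · exact h
        · exact absurd h hne'
    rw [if_neg (by tauto : ¬ (p = j + 1 ∨ p = j + 1 + (n : ZMod (2 * n))))]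
    by_cases hA : (a (j + 1) : QuaternionGroup n) ∈ (barc p p).1
    · rw [if_pos hA, if_pos (key.mp hA)]; exact (by decide : ∀ x : ZMod 2, x + x = 0) _
    · rw [if_neg hA, if_neg (fun h => hA (key.mpr h)), add_zero]

/-- **Window sliding, off-diagonal row**: `[a (j+1) ∈ barc (q+1) q] + [xa j ∈ barc (q+1) q] = 0`. [folklore] -/
theorem window_offdiag (j q : ZMod (2 * n)) :
    ((if (a (j + 1) : QuaternionGroup n) ∈ (barc (q + 1) q).1 then (1 : ZMod 2) else 0) +
        if (xa j : QuaternionGroup n) ∈ (barc (q + 1) q).1 then (1 : ZMod 2) else 0) = 0 := by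
  have key : (a (j + 1) : QuaternionGroup n) ∈ (barc (q + 1) q).1 ↔ (xa j : QuaternionGroup n) ∈ (barc (q + 1) q).1 := by
    rw [a_mem_barc, xa_mem_barc, show j + 1 - (q + 1) = j - q by ring]
  by_cases hA : (a (j + 1) : QuaternionGroup n) ∈ (barc (q + 1) q).1
  · rw [if_pos hA, if_pos (key.mp hA)]; exact (by decide : ∀ x : ZMod 2, x + x = 0) _
  · rw [if_neg hA, if_neg (fun h => hA (key.mpr h)), add_zero]

/-- **Window sliding, diagonal row, second functional**: `[a j ∈ barc p p] + [xa j ∈ barc p p] = 0`. [folklore] -/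
theorem window_diag' (j p : ZMod (2 * n)) :
    ((if (a j : QuaternionGroup n) ∈ (barc p p).1 then (1 : ZMod 2) else 0) +
        if (xa j : QuaternionGroup n) ∈ (barc p p).1 then (1 : ZMod 2) else 0) = 0 := by
  have key : (a j : QuaternionGroup n) ∈ (barc p p).1 ↔ (xa j : QuaternionGroup n) ∈ (barc p p).1 := by
    rw [a_mem_barc, xa_mem_barc]
  by_cases hA : (a j : QuaternionGroup n) ∈ (barc p p).1
  · rw [if_pos hA, if_pos (key.mp hA)]; exact (by decide : ∀ x : ZMod 2, x + x = 0) _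
  · rw [if_neg hA, if_neg (fun h => hA (key.mpr h)), add_zero]

/-- **Window sliding, off-diagonal row, second functional**: `[a j ∈ barc (q+1) q] + [xa j ∈ barc (q+1) q] = [q = j ∨ q = j + n]`. [folklore] -/
theorem window_offdiag' (j q : ZMod (2 * n)) :
    ((if (a j : QuaternionGroup n) ∈ (barc (q + 1) q).1 then (1 : ZMod 2) else 0) +
        if (xa j : QuaternionGroup n) ∈ (barc (q + 1) q).1 then (1 : ZMod 2) else 0) =
      if q = j ∨ q = j + (n : ZMod (2 * n)) then 1 else 0 := by
  have hn := NeZero.ne n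
  by_cases h1 : q = j
  · subst h1
    have hA : (a q : QuaternionGroup n) ∉ (barc (q + 1) q).1 := by
      rw [a_mem_barc, show q - (q + 1) = (-1 : ZMod (2 * n)) by ring, val_neg_one]; omega
    have hX : (xa q : QuaternionGroup n) ∈ (barc (q + 1) q).1 := by
      rw [xa_mem_barc, sub_self, ZMod.val_zero]; omega
    rw [if_neg hA, if_pos hX, if_pos (Or.inl rfl), zero_add]
  by_cases h2 : q = j + (n : ZMod (2 * n))
  · subst h2
    have hA : (a j : QuaternionGroup n) ∈ (barc (j + (n : ZMod (2 * n)) + 1) (j + (n : ZMod (2 * n)))).1 := by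
      rw [a_mem_barc, show j - (j + (n : ZMod (2 * n)) + 1) = -(n : ZMod (2 * n)) - 1 by ring, neg_eq_zero_sub, sub_n_eq_add_n, zero_add]
      exact val_n_sub_one_lt
    have hX : (xa j : QuaternionGroup n) ∉ (barc (j + (n : ZMod (2 * n)) + 1) (j + (n : ZMod (2 * n)))).1 := by
      rw [xa_mem_barc, show j - (j + (n : ZMod (2 * n))) = -(n : ZMod (2 * n)) by ring, neg_eq_zero_sub, sub_n_eq_add_n, zero_add, val_n]; omega
    rw [if_pos hA, if_neg hX, if_pos (Or.inr rfl), add_zero]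
  · have key : (a j : QuaternionGroup n) ∈ (barc (q + 1) q).1 ↔ (xa j : QuaternionGroup n) ∈ (barc (q + 1) q).1 := by
      rw [a_mem_barc, xa_mem_barc, mem_arc_succ_iff j q]
      have hne : j ≠ q := fun h => h1 h.symm
      have hne' : j ≠ q + (n : ZMod (2 * n)) := fun h => h2 (by rw [h, add_assoc, two_n_eq_zero, add_zero])
      constructor
      · rintro (⟨h, -⟩ | h)
        · exact h
        · exact absurd h hne'
      · intro h; exact Or.inl ⟨h, hne⟩
    rw [if_neg (by tauto : ¬ (q = j ∨ q = j + (n : ZMod (2 * n))))]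
    by_cases hA : (a j : QuaternionGroup n) ∈ (barc (q + 1) q).1
    · rw [if_pos hA, if_pos (key.mp hA)]; exact (by decide : ∀ x : ZMod 2, x + x = 0) _
    · rw [if_neg hA, if_neg (fun h => hA (key.mpr h)), add_zero]

/-- **A HODGE VECTOR mod `2` SUPPORTED ON THE DIAGONAL ROWS IS A SUM OF PAIRS.**  If `v ∈ hodge2` has support inside `{barc p p} ∪ {barc (p+1) p}`, its
coefficients are complement-invariant (window sliding against the constant type sum), hence `v ∈ pair2`. [folklore] -/
theorem mem_pair2_of_hodge2_of_rows (v : CMF (QuaternionGroup n) (c n) →₀ ZMod 2) (hv : v ∈ hodge2 (c n) c_mul_c)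
    (hsupp : ∀ Φ ∈ v.support, ∃ p : ZMod (2 * n), Φ = barc p p ∨ Φ = barc (p + 1) p) : v ∈ pair2 (c n) := by
  obtain ⟨k, hk⟩ := exists_forall_ts2_eq_of_mem_hodge2 (c n) c_mul_c c_comm hv
  have heq : ∀ a b : ZMod 2, a + b = 0 → a = b := by decide
  have h10 : (1 : ZMod (2 * n)) ≠ 0 := fun h => by
    have h' := congrArg ZMod.val h; rw [val_one_eq, ZMod.val_zero] at h'; exact one_ne_zero h'
  -- the two functionals vanish on `v`
  have hφ : ∀ x y : QuaternionGroup n, ∑ Φ ∈ v.support, v Φ * ((if x ∈ Φ.1 then (1 : ZMod 2) else 0) + if y ∈ Φ.1 then 1 else 0) = 0 := by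
    intro x y
    rw [Finset.sum_congr rfl fun Φ _ => mul_add (v Φ) _ _, Finset.sum_add_distrib, ← ts2_apply_eq_sum, ← ts2_apply_eq_sum, hk, hk]
    exact (by decide : ∀ x : ZMod 2, x + x = 0) k
  refine mem_pair2_of_forall_apply_eq v.support.card v le_rfl fun Ψ => ?_
  -- reduce to `Ψ` on the rows (the rows are closed under `·c⁻¹`)
  have hrows_c : ∀ Φ, (∃ p : ZMod (2 * n), Φ = barc p p ∨ Φ = barc (p + 1) p) →
      ∃ p : ZMod (2 * n), rt (c n) (c n) Φ = barc p p ∨ rt (c n) (c n) Φ = barc (p + 1) p := by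
    rintro Φ ⟨p, rfl | rfl⟩
    · exact ⟨p + (n : ZMod (2 * n)), Or.inl (rt_c_barc p p)⟩
    · exact ⟨p + (n : ZMod (2 * n)), Or.inr (by rw [rt_c_barc]; congr 1; ring)⟩
  by_cases hΨ : ∃ p : ZMod (2 * n), Ψ = barc p p ∨ Ψ = barc (p + 1) p
  swap
  · -- off the rows both coefficients vanish
    have h1 : v Ψ = 0 := by
      by_contra h; exact hΨ (hsupp Ψ (Finsupp.mem_support_iff.mpr h))
    have h2 : v (rt (c n) (c n) Ψ) = 0 := by
      by_contra h
      obtain ⟨p, hp⟩ := hrows_c _ (hsupp _ (Finsupp.mem_support_iff.mpr h))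
      rw [rt_c_rt_c] at hp
      exact hΨ ⟨p, hp⟩
    rw [h1, h2]
  obtain ⟨p, rfl | rfl⟩ := hΨ
  · -- diagonal row: slide the window at `a (j+1)`, `xa j` with `j = p − 1`
    have h := hφ (a (p - 1 + 1)) (xa (p - 1))
    have hterm : ∀ Φ ∈ v.support, v Φ * ((if (a (p - 1 + 1) : QuaternionGroup n) ∈ Φ.1 then (1 : ZMod 2) else 0) +
        if (xa (p - 1) : QuaternionGroup n) ∈ Φ.1 then 1 else 0) =
        (if Φ = barc p p then v Φ else 0) + if Φ = barc (p + (n : ZMod (2 * n))) (p + (n : ZMod (2 * n))) then v Φ else 0 := by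
      intro Φ hΦ
      obtain ⟨p', rfl | rfl⟩ := hsupp Φ hΦ
      · rw [window_diag, sub_add_cancel]
        by_cases e1 : p' = p
        · subst e1
          rw [if_pos (Or.inl rfl), if_pos rfl, if_neg (fun h => self_ne_add_n p' (barc_inj h).1), mul_one, add_zero]
        by_cases e2 : p' = p + (n : ZMod (2 * n))
        · subst e2
          rw [if_pos (Or.inr rfl), if_neg (fun h => self_ne_add_n p (barc_inj h).1.symm), if_pos rfl, mul_one, zero_add]
        · rw [if_neg (by tauto), if_neg (fun h => e1 (barc_inj h).1), if_neg (fun h => e2 (barc_inj h).1), mul_zero, add_zero]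
      · rw [window_offdiag, mul_zero, if_neg, if_neg, add_zero]
        · intro h; exact h10 (by linear_combination (barc_inj h).1 - (barc_inj h).2)
        · intro h; exact h10 (by linear_combination (barc_inj h).1 - (barc_inj h).2)
    rw [Finset.sum_congr rfl hterm, Finset.sum_add_distrib, Finset.sum_ite_eq' v.support (barc p p), Finset.sum_ite_eq'] at h
    rw [rt_c_barc]
    have e1 : (if barc p p ∈ v.support then v (barc p p) else 0) = v (barc p p) := by
      by_cases hm : barc p p ∈ v.support
      · rw [if_pos hm]
      · rw [if_neg hm, Finsupp.notMem_support_iff.mp hm]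
    have e2 : (if barc (p + (n : ZMod (2 * n))) (p + (n : ZMod (2 * n))) ∈ v.support then v (barc (p + (n : ZMod (2 * n))) (p + (n : ZMod (2 * n)))) else 0) = v (barc (p + (n : ZMod (2 * n))) (p + (n : ZMod (2 * n)))) := by
      by_cases hm : barc (p + (n : ZMod (2 * n))) (p + (n : ZMod (2 * n))) ∈ v.support
      · rw [if_pos hm]
      · rw [if_neg hm, Finsupp.notMem_support_iff.mp hm]
    rw [e1, e2] at h
    exact heq _ _ h
  · -- off-diagonal row: slide the window at `a j`, `xa j` with `j = p`
    have h := hφ (a p) (xa p)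
    have hterm : ∀ Φ ∈ v.support, v Φ * ((if (a p : QuaternionGroup n) ∈ Φ.1 then (1 : ZMod 2) else 0) +
        if (xa p : QuaternionGroup n) ∈ Φ.1 then 1 else 0) =
        (if Φ = barc (p + 1) p then v Φ else 0) + if Φ = barc (p + (n : ZMod (2 * n)) + 1) (p + (n : ZMod (2 * n))) then v Φ else 0 := by
      intro Φ hΦ
      obtain ⟨p', rfl | rfl⟩ := hsupp Φ hΦ
      · rw [window_diag', mul_zero, if_neg, if_neg, add_zero]
        · intro h; exact h10 (by linear_combination (barc_inj h).2 - (barc_inj h).1)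
        · intro h; exact h10 (by linear_combination (barc_inj h).2 - (barc_inj h).1)
      · rw [window_offdiag']
        by_cases e1 : p' = p
        · subst e1
          rw [if_pos (Or.inl rfl), if_pos rfl, if_neg (fun h => self_ne_add_n p' (barc_inj h).2), mul_one, add_zero]
        by_cases e2 : p' = p + (n : ZMod (2 * n))
        · subst e2
          rw [if_pos (Or.inr rfl), if_neg (fun h => self_ne_add_n p (barc_inj h).2.symm), if_pos rfl, mul_one, zero_add]
        · rw [if_neg (by tauto), if_neg (fun h => e1 (barc_inj h).2), if_neg (fun h => e2 (barc_inj h).2), mul_zero, add_zero]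
    rw [Finset.sum_congr rfl hterm, Finset.sum_add_distrib, Finset.sum_ite_eq' v.support (barc (p + 1) p), Finset.sum_ite_eq'] at h
    have ec : rt (c n) (c n) (barc (p + 1) p) = barc (p + (n : ZMod (2 * n)) + 1) (p + (n : ZMod (2 * n))) := by rw [rt_c_barc]; congr 1; ring
    rw [ec]
    have e1 : (if barc (p + 1) p ∈ v.support then v (barc (p + 1) p) else 0) = v (barc (p + 1) p) := by
      by_cases hm : barc (p + 1) p ∈ v.support
      · rw [if_pos hm]
      · rw [if_neg hm, Finsupp.notMem_support_iff.mp hm]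
    have e2 : (if barc (p + (n : ZMod (2 * n)) + 1) (p + (n : ZMod (2 * n))) ∈ v.support then v (barc (p + (n : ZMod (2 * n)) + 1) (p + (n : ZMod (2 * n)))) else 0) = v (barc (p + (n : ZMod (2 * n)) + 1) (p + (n : ZMod (2 * n)))) := by
      by_cases hm : barc (p + (n : ZMod (2 * n)) + 1) (p + (n : ZMod (2 * n))) ∈ v.support
      · rw [if_pos hm]
      · rw [if_neg hm, Finsupp.notMem_support_iff.mp hm]
    rw [e1, e2] at h
    exact heq _ _ h

/-! ## §3 RESIDUAL GENERATION MOD `2` by the explicit family -/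

/-- **RESIDUAL GENERATION MOD `2`** (hypothesis (R) of `Census/QuaternionColumnEven(Pivot).lean`, every `n ≥ 3`): every Hodge vector mod `2` supported on
the residual types of `T₀ = barc 0 0` lies in `pair2 + 𝔽₂⟨base changes of red (qfam n)⟩`. [folklore] -/
theorem residual_generation_qfam (h3 : 3 ≤ n) : ∀ y ∈ hodge2 (c n) c_mul_c,
    y ∈ Finsupp.supported (ZMod 2) (ZMod 2) {Ψ : CMF (QuaternionGroup n) (c n) | bpot (c n) (barc 0 0) Ψ ≤ 1} →
      y ∈ pair2 (c n) ⊔ Submodule.span (ZMod 2) (translates2 (c n) ((qfam n).image (red (c n)))) := by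
  intro y hy hyR
  set T := pair2 (c n) ⊔ Submodule.span (ZMod 2) (translates2 (c n) ((qfam n).image (red (c n)))) with hT
  set Rows : Set (CMF (QuaternionGroup n) (c n)) := {Ψ | ∃ p : ZMod (2 * n), Ψ = barc p p ∨ Ψ = barc (p + 1) p} with hRows
  -- `y ∈ T + 𝔽₂⟨rows⟩`
  have hyD : y ∈ T ⊔ Submodule.span (ZMod 2) ((fun Ψ => Finsupp.single Ψ (1 : ZMod 2)) '' Rows) := by
    rw [Finsupp.supported_eq_span_single] at hyR
    refine (Submodule.span_le.mpr ?_) hyR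
    rintro _ ⟨Ψ, hΨ, rfl⟩
    exact single_mem_target_sup_rows_of_bpot_le_one h3 hΨ
  obtain ⟨t, ht, r, hr, rfl⟩ := Submodule.mem_sup.mp hyD
  -- `r` is a Hodge vector supported on the rows
  have hTle : T ≤ hodge2 (c n) c_mul_c := by
    refine sup_le le_sup_right (Submodule.span_le.mpr ?_)
    rintro _ ⟨Q, s, hs, rfl⟩
    obtain ⟨f, hf, rfl⟩ := mem_image.mp hs
    exact mapDomain_rt_mem_hodge2 (c n) c_mul_c c_comm Q
      (red_mem_hodge2 (c n) c_mul_c (gfaceSet_subset_hodgeSpan (c n) c_mul_c (qfam_subset_gfaceSet h3 hf)))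
  have hrH : r ∈ hodge2 (c n) c_mul_c := by
    have e : r = (t + r) - t := by abel
    rw [e]; exact Submodule.sub_mem _ hy (hTle ht)
  have hrsupp : ∀ Φ ∈ r.support, ∃ p : ZMod (2 * n), Φ = barc p p ∨ Φ = barc (p + 1) p := by
    rw [← Finsupp.supported_eq_span_single] at hr
    exact fun Φ hΦ => hr hΦ
  exact Submodule.add_mem _ ht (Submodule.mem_sup_left (mem_pair2_of_hodge2_of_rows r hrH hrsupp))

/-! ## §4 THE LAW -/

/-- **THE QUATERNION LAW AT EVEN LEVEL: `μ(Q_{4n}, c) = φ₂(Q_{4n}, c)` for EVERY even `n ≥ 4`** (`G = QuaternionGroup n` of order `4n`, `c = a n`): the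
least number of rank-four face relations whose base changes generate the integer Hodge lattice of `(G, c)` modulo pairs is EXACTLY the coinvariant fibre
dimension `φ₂(G, c)`. [folklore] -/
theorem isLeast_card_gfaces_generate_quaternion_even_law (heven : Even n) (h4 : 4 ≤ n) :
    IsLeast {k : ℕ | ∃ S : Finset (CMF (QuaternionGroup n) (c n) →₀ ℤ), (↑S ⊆ gfaceSet (QuaternionGroup n) (c n) c_mul_c) ∧ S.card = k ∧
      hodgeSpan (c n) c_mul_c ≤ Submodule.span ℤ (pairSet (c n)) ⊔ Submodule.span ℤ (translates (c n) S)} (fibreTwo (c n) c_mul_c) :=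
  isLeast_card_gfaces_generate_quaternion_even heven h4 (residual_generation_qfam (by omega))

/-- **Existence form**: for every even `n ≥ 4` there are exactly `φ₂(Q_{4n}, c)` face relations, containing gen 39ʼs explicit family `qfam n`, whose base
changes generate the Hodge lattice modulo pairs. [folklore] -/
theorem exists_gfaces_generate_quaternion_even (heven : Even n) (h4 : 4 ≤ n) :
    ∃ S : Finset (CMF (QuaternionGroup n) (c n) →₀ ℤ), qfam n ⊆ S ∧ (↑S ⊆ gfaceSet (QuaternionGroup n) (c n) c_mul_c) ∧
      S.card = fibreTwo (c n) c_mul_c ∧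
        hodgeSpan (c n) c_mul_c ≤ Submodule.span ℤ (pairSet (c n)) ⊔ Submodule.span ℤ (translates (c n) S) :=
  exists_generate_card_eq_fibreTwo_of_indep_of_residual heven h4 (qfam_fibreIndep' heven h4) (residual_generation_qfam (by omega))

end

end Summit.HodgeConjecture.CorCM.Census.QuaternionColumn
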